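import Mathlib
import Literature.Probability.LatticeModels.GKSInequalities
import Literature.Probability.LatticeModels.IsingInverseMCertificate
import Literature.Probability.LatticeModels.IsingInverseMCertificateSound
import HarnessLib

/-!
# Symmetry-reduced inverse-M certificates (`IsingPolynomial.checkSym`)

The checker `IsingPolynomial.check` verifies the polynomial identity `M(v)·B(v) = d(v)·1` row by
row for all `n` rows, and re-derives every entry of the Edwards–Sokal matrix `M` by enumeration of
`{±1}^n`.  For a graph with automorphisms this is `|Aut|`-fold redundant.  `checkSym` takes in
addition a list `rows` of rows that are verified in full and a list of GENERATORS, each a vertex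
permutation `π` (image list) with an edge permutation `τ` witnessing that `π` maps the edge list to
itself; it checks that `B` is `π`-invariant and that the orbit of `rows` under the generated group is
everything; the enumeration uses the fast `entryF` (= `entry`: bit tests and a table of binomial rows).  Soundness (`inv_entry_nonpos_of_checkSym`): the TRUE matrix `M(v)` is `π`-invariant for
every automorphism (relabelling of spin configurations), so the row identity transports from `p` to
`π p`; the rest is `inv_entry_nonpos_of_mul_eq`.  For a vertex-transitive graph one row suffices,
which divides the enumeration cost by `n`. [cite: FriedliVelenik2017, §3.8.1]
-/

namespace Literature.Probability.LatticeModels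

namespace IsingPolynomial

open Finset Matrix

/-! ### A faster enumeration (bit tests, table of binomial rows), definitionally equal to `entry` -/

/-- The rows `(1+v)^0, …, (1+v)^m`, computed once. [folklore] -/
def powTable (m : ℕ) : List (List ℤ) := (List.range (m + 1)).map onePlusPow

/-- Spin at site `p` of configuration `k`, by a bit test. [folklore] -/
def spinOfF (k p : ℕ) : ℤ := if k.testBit p then 1 else -1

/-- Number of satisfied edges of configuration `k`, by bit tests. [folklore] -/
def satCountF (k : ℕ) : List (ℕ × ℕ) → ℕ
  | [] => 0
  | e :: es => if (k.testBit e.1 == k.testBit e.2) = true then satCountF k es + 1 else satCountF k es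

/-- `term` with bit tests and the binomial rows looked up in a table. [folklore] -/
def termF (T : List (List ℤ)) (E : List (ℕ × ℕ)) (p q k : ℕ) : List ℤ :=
  lsmul (spinOfF k p * spinOfF k q) (T.getD (satCountF k E) [])

/-- `entry` computed with bit tests and a table of binomial rows (same value, much cheaper to
evaluate natively). [folklore] -/
def entryF (n : ℕ) (E : List (ℕ × ℕ)) (p q : ℕ) : List ℤ :=
  cfgSum (termF (powTable E.length) E p q) n 0

/-- The number of satisfied edges is at most the number of edges. [folklore] -/
theorem satCount_le (k : ℕ) (l : List (ℕ × ℕ)) : satCount k l ≤ l.length := by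
  induction l with
  | nil => simp [satCount]
  | cons e es ih => simp only [satCount, List.length_cons]; split_ifs <;> omega

/-- Table lookup returns the binomial row. [folklore] -/
theorem powTable_getD {m s : ℕ} (hs : s ≤ m) : (powTable m).getD s [] = onePlusPow s := by
  rw [powTable, List.getD_eq_getElem _ _ (by simpa using Nat.lt_succ_of_le hs)]
  simp

/-- `spinOfF = spinOf`. [folklore] -/
theorem spinOfF_eq (k p : ℕ) : spinOfF k p = spinOf k p := by
  simp [spinOfF, spinOf, bit, Nat.testBit_eq_decide_div_mod_eq]

/-- `satCountF = satCount`. [folklore] -/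
theorem satCountF_eq (k : ℕ) (l : List (ℕ × ℕ)) : satCountF k l = satCount k l := by
  induction l with
  | nil => rfl
  | cons e es ih =>
    have h1 : bit k e.1 < 2 := Nat.mod_lt _ (by norm_num)
    have h2 : bit k e.2 < 2 := Nat.mod_lt _ (by norm_num)
    have key : ∀ x, x < 2 → ∀ y, y < 2 →
        (((decide (x = 1) == decide (y = 1)) = true) ↔ x = y) := by decide
    have hiff : ((k.testBit e.1 == k.testBit e.2) = true) ↔ bit k e.1 = bit k e.2 := by
      rw [Nat.testBit_eq_decide_div_mod_eq, Nat.testBit_eq_decide_div_mod_eq]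
      exact key _ h1 _ h2
    simp only [satCountF, satCount, ih]
    by_cases h : bit k e.1 = bit k e.2
    · rw [if_pos (hiff.2 h), if_pos h]
    · rw [if_neg (mt hiff.1 h), if_neg h]

/-- `entryF = entry`. [folklore] -/
theorem entryF_eq (n : ℕ) (E : List (ℕ × ℕ)) (p q : ℕ) : entryF n E p q = entry n E p q := by
  unfold entryF entry
  congr 1
  funext k
  rw [termF, term, spinOfF_eq, spinOfF_eq, satCountF_eq, powTable_getD (satCount_le k E)]

/-! ### The checker -/

/-- A permutation given by its list of images, read as a function on `ℕ` (junk `0` out of range). [folklore] -/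
def permAt (pi : List ℕ) (p : ℕ) : ℕ := pi.getD p 0

/-- `pi` lists `n` images below `n` without repetition (so it is a permutation of `range n`). [folklore] -/
def permOK (n : ℕ) (pi : List ℕ) : Bool :=
  (pi.length == n) && ((List.range n).all fun a => decide (permAt pi a < n)) &&
  ((List.range n).all fun a => (List.range n).all fun b => (a == b) || !(permAt pi a == permAt pi b))

/-- `tau` is an injective self-map of the edge indices and edge `i` is carried by `pi` onto edge
`tau i` (as an unordered pair). [folklore] -/
def edgePermOK (E : List (ℕ × ℕ)) (pi tau : List ℕ) : Bool :=
  ((List.range E.length).all fun i => decide (permAt tau i < E.length)) &&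
  ((List.range E.length).all fun i => (List.range E.length).all fun i' =>
      (i == i') || !(permAt tau i == permAt tau i')) &&
  ((List.range E.length).all fun i =>
      (permAt pi (E.getD i (0, 0)).1 == (E.getD (permAt tau i) (0, 0)).1 &&
        permAt pi (E.getD i (0, 0)).2 == (E.getD (permAt tau i) (0, 0)).2) ||
      (permAt pi (E.getD i (0, 0)).1 == (E.getD (permAt tau i) (0, 0)).2 &&
        permAt pi (E.getD i (0, 0)).2 == (E.getD (permAt tau i) (0, 0)).1))

/-- The certificate matrix `B` is invariant under `pi` (entrywise, as polynomials). [folklore] -/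
def bInvariantOK (n : ℕ) (Bcls : List (List ℤ)) (Bidx : List (List ℕ)) (pi : List ℕ) : Bool :=
  (List.range n).all fun p => (List.range n).all fun q =>
    lEq (getB Bcls Bidx (permAt pi p) (permAt pi q)) (getB Bcls Bidx p q)

/-- One closure step: a row is covered if it was, or is the image of a covered row under a generator. [folklore] -/
def coverStep (n : ℕ) (gens : List (List ℕ × List ℕ)) (cov : List Bool) : List Bool :=
  (List.range n).map fun q => cov.getD q false ||
    gens.any fun g => (List.range n).any fun p => cov.getD p false && (permAt g.1 p == q)

/-- Iterated closure. [folklore] -/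
def coverIter (n : ℕ) (gens : List (List ℕ × List ℕ)) : ℕ → List Bool → List Bool
  | 0, cov => cov
  | k + 1, cov => coverIter n gens k (coverStep n gens cov)

/-- Every row below `n` lies in the orbit of `rows` under the generators (closure after `n` steps). [folklore] -/
def coverAll (n : ℕ) (rows : List ℕ) (gens : List (List ℕ × List ℕ)) : Bool :=
  (List.range n).all fun q =>
    (coverIter n gens n ((List.range n).map fun q' => rows.any fun r => r == q')).getD q false

/-- The symmetry-reduced checker WITHOUT the re-enumeration of the rows of `M` (the caller must know
that `Mtab` holds the true Edwards–Sokal rows, see `inv_entry_nonpos_of_checkSymCore`): rows below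
`n`; `Mtab·B = d·1` on `rows`; `d` has nonnegative coefficients and positive constant; off-diagonal
entries of `B` have nonpositive coefficients; every generator is a graph automorphism leaving `B`
invariant; the orbit of `rows` is everything. [folklore] -/
def checkSymCore (n : ℕ) (E : List (ℕ × ℕ)) (Mtab : List (List (List ℤ))) (Bcls : List (List ℤ))
    (Bidx : List (List ℕ)) (d : List ℤ) (rows : List ℕ) (gens : List (List ℕ × List ℕ)) : Bool :=
  edgesOK n E &&
  (rows.all fun p => decide (p < n)) &&
  (rows.all fun p => (List.range n).all fun q =>
      lEq (prodEntry n Mtab Bcls Bidx p q) (if p = q then d else [])) &&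
  (lNonneg d && lPosHead d) &&
  ((List.range n).all fun p => (List.range n).all fun q => (p == q) || lNonpos (getB Bcls Bidx p q)) &&
  (gens.all fun g => permOK n g.1 && edgePermOK E g.1 g.2 && bInvariantOK n Bcls Bidx g.1) &&
  coverAll n rows gens

/-- The symmetry-reduced certificate checker (see the module docstring): the rows `rows` of the
claimed table `Mtab` are re-derived by enumeration (`entryF`), then `checkSymCore`. [folklore] -/
def checkSym (n : ℕ) (E : List (ℕ × ℕ)) (Mtab : List (List (List ℤ))) (Bcls : List (List ℤ))
    (Bidx : List (List ℕ)) (d : List ℤ) (rows : List ℕ) (gens : List (List ℕ × List ℕ)) : Bool :=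
  (rows.all fun p => (List.range n).all fun q => lEq (getPoly Mtab p q) (entryF n E p q)) &&
  checkSymCore n E Mtab Bcls Bidx d rows gens

/-! ### Soundness -/

section Soundness

variable {n : ℕ} {E : List (ℕ × ℕ)}

/-- The vertex permutation of a valid generator, as a map of `Fin n`. [folklore] -/
def permFin (pi : List ℕ) (h : ∀ a < n, permAt pi a < n) (a : Fin n) : Fin n :=
  ⟨permAt pi a, h a a.2⟩

/-- Unpack `permOK`. [folklore] -/
theorem permOK_spec {pi : List ℕ} (h : permOK n pi = true) :
    (∀ a < n, permAt pi a < n) ∧ ∀ a < n, ∀ b < n, permAt pi a = permAt pi b → a = b := by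
  simp only [permOK, Bool.and_eq_true, List.all_eq_true, List.mem_range, decide_eq_true_eq,
    Bool.or_eq_true, beq_iff_eq, Bool.not_eq_true', beq_eq_false_iff_ne, ne_eq] at h
  obtain ⟨⟨-, h1⟩, h2⟩ := h
  refine ⟨h1, fun a ha b hb hab => ?_⟩
  rcases h2 a ha b hb with h | h
  · exact h
  · exact absurd hab h

/-- The vertex permutation of a valid generator as an equivalence of `Fin n`. [folklore] -/
noncomputable def permEquiv (pi : List ℕ) (h : permOK n pi = true) : Fin n ≃ Fin n :=
  Equiv.ofBijective (permFin pi (permOK_spec h).1)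
    (Finite.injective_iff_bijective.1 fun a b hab =>
      Fin.ext ((permOK_spec h).2 a a.2 b b.2 (Fin.mk.inj_iff.1 hab)))

/-- The value of `permEquiv` is `permAt`. [folklore] -/
@[simp] theorem permEquiv_apply_val (pi : List ℕ) (h : permOK n pi = true) (a : Fin n) :
    ((permEquiv pi h a : Fin n) : ℕ) = permAt pi a := rfl

/-- `spinN` of a relabelled configuration. [folklore] -/
theorem spinN_comp (pi : List ℕ) (h : permOK n pi = true) (ω : SpinConfig (Fin n)) {a : ℕ}
    (ha : a < n) : spinN (ω ∘ permEquiv pi h) a = spinN ω (permAt pi a) := by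
  rw [spinN, dif_pos ha, spinN, dif_pos ((permOK_spec h).1 a ha)]
  rfl

/-- Unpack `edgePermOK` at an edge index. [folklore] -/
theorem edgePermOK_spec {pi tau : List ℕ} (h : edgePermOK E pi tau = true) :
    (∀ i < E.length, permAt tau i < E.length) ∧
    (∀ i < E.length, ∀ i' < E.length, permAt tau i = permAt tau i' → i = i') ∧
    (∀ i < E.length,
      (permAt pi (E.getD i (0, 0)).1 = (E.getD (permAt tau i) (0, 0)).1 ∧
          permAt pi (E.getD i (0, 0)).2 = (E.getD (permAt tau i) (0, 0)).2) ∨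
      (permAt pi (E.getD i (0, 0)).1 = (E.getD (permAt tau i) (0, 0)).2 ∧
          permAt pi (E.getD i (0, 0)).2 = (E.getD (permAt tau i) (0, 0)).1)) := by
  simp only [edgePermOK, Bool.and_eq_true, List.all_eq_true, List.mem_range, decide_eq_true_eq,
    Bool.or_eq_true, beq_iff_eq, Bool.not_eq_true', beq_eq_false_iff_ne, ne_eq] at h
  obtain ⟨⟨h1, h2⟩, h3⟩ := h
  refine ⟨h1, fun i hi i' hi' hh => ?_, h3⟩
  rcases h2 i hi i' hi' with h | h
  · exact h
  · exact absurd hh h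

/-- The edge permutation of a valid generator as an equivalence of `Fin E.length`. [folklore] -/
noncomputable def edgeEquiv (pi tau : List ℕ) (h : edgePermOK E pi tau = true) :
    Fin E.length ≃ Fin E.length :=
  Equiv.ofBijective (fun i => ⟨permAt tau i, (edgePermOK_spec h).1 i i.2⟩)
    (Finite.injective_iff_bijective.1 fun a b hab =>
      Fin.ext ((edgePermOK_spec h).2.1 a a.2 b b.2 (Fin.mk.inj_iff.1 hab)))

/-- The Edwards–Sokal factor of edge `i` at the relabelled configuration is the factor of edge `τ i`. [folklore] -/
theorem factor_comp {pi tau : List ℕ} (hE : edgesOK n E = true) (hpi : permOK n pi = true)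
    (htau : edgePermOK E pi tau = true) (ω : SpinConfig (Fin n)) (v : ℝ) (i : Fin E.length) :
    (if spinN (ω ∘ permEquiv pi hpi) (E[i.1]).1 = spinN (ω ∘ permEquiv pi hpi) (E[i.1]).2
      then 1 + v else (1 : ℝ)) =
    (if spinN ω (E[(edgeEquiv pi tau htau i).1]).1 = spinN ω (E[(edgeEquiv pi tau htau i).1]).2
      then 1 + v else (1 : ℝ)) := by
  obtain ⟨ha, hb, -⟩ := edgesOK_get hE i
  rw [spinN_comp pi hpi ω ha, spinN_comp pi hpi ω hb]
  have h3 := (edgePermOK_spec htau).2.2 i i.2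
  have hgi : E.getD i (0, 0) = E[i.1] := List.getD_eq_getElem _ _ i.2
  have hgt : E.getD (permAt tau i) (0, 0) = E[(edgeEquiv pi tau htau i).1] :=
    List.getD_eq_getElem _ _ _
  rw [hgi, hgt] at h3
  rcases h3 with ⟨h1, h2⟩ | ⟨h1, h2⟩
  · rw [h1, h2]
  · rw [h1, h2]
    by_cases hc : spinN ω (E[(edgeEquiv pi tau htau i).1]).2 =
        spinN ω (E[(edgeEquiv pi tau htau i).1]).1
    · rw [if_pos hc, if_pos hc.symm]
    · rw [if_neg hc, if_neg (fun h' => hc h'.symm)]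

/-- **The true Edwards–Sokal matrix is invariant under graph automorphisms.** [folklore] -/
theorem entry_perm_invariant {pi tau : List ℕ} (hE : edgesOK n E = true) (hpi : permOK n pi = true)
    (htau : edgePermOK E pi tau = true) (v : ℝ) (p q : Fin n) :
    leval (entry n E (permEquiv pi hpi p) (permEquiv pi hpi q)) v = (leval (entry n E p q) v : ℝ) := by
  rw [← esSum_eq_leval_entry hE, ← esSum_eq_leval_entry hE]
  simp_rw [prod_factor_eq hE]
  -- relabel configurations on the right: ω ↦ ω ∘ π
  conv_rhs => rw [← Equiv.sum_comp ((permEquiv pi hpi).symm.arrowCongr (Equiv.refl ℤˣ))]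
  refine Finset.sum_congr rfl fun ω _ => ?_
  have hcomp : ((permEquiv pi hpi).symm.arrowCongr (Equiv.refl ℤˣ)) ω = ω ∘ permEquiv pi hpi := by
    ext a; simp [Equiv.arrowCongr_apply]
  rw [hcomp,
    show spinAt p (ω ∘ ⇑(permEquiv pi hpi)) = spinAt (permEquiv pi hpi p) ω from rfl,
    show spinAt q (ω ∘ ⇑(permEquiv pi hpi)) = spinAt (permEquiv pi hpi q) ω from rfl]
  congr 1
  -- the satisfied-edge count is invariant: reindex the product over edges by `τ`
  rw [← prod_map_factor ω v E, ← prod_map_factor (ω ∘ permEquiv pi hpi) v E,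
    ← Fin.prod_univ_fun_getElem E, ← Fin.prod_univ_fun_getElem E]
  simp_rw [factor_comp hE hpi htau ω v]
  exact (Equiv.prod_comp (edgeEquiv pi tau htau)
    (fun j => if spinN ω (E[j.1]).1 = spinN ω (E[j.1]).2 then 1 + v else (1 : ℝ))).symm

/-- Semantics of `coverStep`. [folklore] -/
theorem coverStep_getD {gens : List (List ℕ × List ℕ)} {cov : List Bool} {q : ℕ} (hq : q < n)
    (h : (coverStep n gens cov).getD q false = true) :
    cov.getD q false = true ∨ ∃ g ∈ gens, ∃ p < n, cov.getD p false = true ∧ permAt g.1 p = q := by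
  rw [coverStep, List.getD_eq_getElem _ _ (by simpa using hq)] at h
  simp only [List.getElem_map, List.getElem_range, Bool.or_eq_true, List.any_eq_true, List.mem_range,
    Bool.and_eq_true, beq_iff_eq] at h
  rcases h with h | ⟨g, hg, p, hp, hc, hpq⟩
  · exact Or.inl h
  · exact Or.inr ⟨g, hg, p, hp, hc, hpq⟩

/-- Closure induction: a property stable under the generators and true on the seed rows holds on
every covered row. [folklore] -/
theorem coverIter_induction {gens : List (List ℕ × List ℕ)} (P : ℕ → Prop)
    (hstep : ∀ g ∈ gens, ∀ p < n, P p → P (permAt g.1 p)) :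
    ∀ (k : ℕ) (cov : List Bool), (∀ q < n, cov.getD q false = true → P q) →
      ∀ q < n, (coverIter n gens k cov).getD q false = true → P q := by
  intro k
  induction k with
  | zero => intro cov hcov q hq h; exact hcov q hq h
  | succ k ih =>
    intro cov hcov q hq h
    refine ih (coverStep n gens cov) (fun q' hq' h' => ?_) q hq h
    rcases coverStep_getD hq' h' with h0 | ⟨g, hg, p, hp, hc, hpq⟩
    · exact hcov q' hq' h0
    · exact hpq ▸ hstep g hg p hp (hcov p hp hc)

/-- **Soundness of the core checker**, given that the rows `rows` of `Mtab` evaluate to the true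
Edwards–Sokal rows. [folklore] -/
theorem inv_entry_nonpos_of_checkSymCore {Mtab : List (List (List ℤ))} {Bcls : List (List ℤ)}
    {Bidx : List (List ℕ)} {d : List ℤ} {rows : List ℕ} {gens : List (List ℕ × List ℕ)}
    (h : checkSymCore n E Mtab Bcls Bidx d rows gens = true)
    (hM : ∀ p ∈ rows, p < n → ∀ q < n, ∀ v : ℝ, leval (getPoly Mtab p q) v = leval (entry n E p q) v)
    (K : ℝ) (hK : 0 ≤ K) (x y : Fin n) (hxy : x ≠ y) :
    (Matrix.of fun p q : Fin n => gksExpect Finset.univ (fun _ : Fin E.length => K) (edgeSet n E)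
        (fun ω => spinAt p ω * spinAt q ω))⁻¹ x y ≤ 0 := by
  simp only [checkSymCore, Bool.and_eq_true] at h
  obtain ⟨⟨⟨⟨⟨⟨hE, hrows⟩, hP⟩, ⟨hd, hd0⟩⟩, hB⟩, hgens⟩, hcov⟩ := h
  set v : ℝ := Real.exp (2 * K) - 1 with hv_def
  have hv : 0 ≤ v := sub_nonneg.2 (Real.one_le_exp (by linarith))
  set Mv : Matrix (Fin n) (Fin n) ℝ := Matrix.of fun p q : Fin n => leval (entry n E p q) v with hMv
  set Bv : Matrix (Fin n) (Fin n) ℝ := Matrix.of fun p q : Fin n => leval (getB Bcls Bidx p q) v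
    with hBv
  have hdpos : 0 < leval d v := leval_pos hd hd0 hv
  -- row identity predicate
  let Good : ℕ → Prop := fun p => ∀ (hp : p < n) (q : Fin n),
    (Mv * Bv) ⟨p, hp⟩ q = if p = (q : ℕ) then leval d v else 0
  -- (A) seed rows
  have hseed : ∀ p ∈ rows, Good p := by
    intro p hpr hp q
    have hPp := List.all_eq_true.1 hP p hpr
    have hMp := hM p hpr hp
    have key := leval_eq_of_lEq v (all_range hPp q.2)
    rw [prodEntry, leval_lsum, List.map_map] at key
    have hsum : ∑ r : Fin n, leval (entry n E p r) v * leval (getB Bcls Bidx r q) v =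
        leval (if p = (q : ℕ) then d else []) v := by
      rw [← key, Fin.sum_univ_eq_sum_range
        (fun r => leval (entry n E p r) v * leval (getB Bcls Bidx r q) v) n, ← list_sum_range_eq]
      congr 1
      refine List.map_congr_left fun r hr => ?_
      simp only [Function.comp, leval_lmul]
      rw [hMp r (List.mem_range.1 hr) v]
    simp only [hMv, hBv, Matrix.mul_apply, Matrix.of_apply]
    rw [hsum]
    split_ifs <;> simp
  -- (B) transport along a generator
  have hstep : ∀ g ∈ gens, ∀ p < n, Good p → Good (permAt g.1 p) := by
    intro g hg p hp hgood hπp q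
    have hg' := List.all_eq_true.1 hgens g hg
    simp only [Bool.and_eq_true] at hg'
    obtain ⟨⟨hpi, htau⟩, hBinv⟩ := hg'
    set π := permEquiv g.1 hpi with hπ
    have hπp_eq : (⟨permAt g.1 p, hπp⟩ : Fin n) = π ⟨p, hp⟩ := Fin.ext rfl
    -- B invariance, evaluated
    have hBi : ∀ r s : Fin n, Bv (π r) (π s) = Bv r s := by
      intro r s
      simp only [hBv, Matrix.of_apply]
      exact leval_eq_of_lEq v (all_range (all_range hBinv r.2) s.2)
    have hMi : ∀ r s : Fin n, Mv (π r) (π s) = Mv r s := by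
      intro r s
      simp only [hMv, Matrix.of_apply]
      exact entry_perm_invariant hE hpi htau v r s
    rw [hπp_eq, Matrix.mul_apply, ← Equiv.sum_comp π]
    have hq : q = π (π.symm q) := (Equiv.apply_symm_apply π q).symm
    conv_lhs => rw [hq]
    simp_rw [hMi, hBi]
    have := hgood hp (π.symm q)
    rw [Matrix.mul_apply] at this
    rw [this]
    have hiff : p = ((π.symm q : Fin n) : ℕ) ↔ permAt g.1 p = (q : ℕ) := by
      constructor
      · intro h1
        have h2 : (⟨p, hp⟩ : Fin n) = π.symm q := Fin.ext h1
        have h3 : π ⟨p, hp⟩ = q := by rw [h2, Equiv.apply_symm_apply]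
        exact congrArg Fin.val h3
      · intro h1
        have h2 : π ⟨p, hp⟩ = q := Fin.ext h1
        have h3 : (⟨p, hp⟩ : Fin n) = π.symm q := by rw [← h2, Equiv.symm_apply_apply]
        exact congrArg Fin.val h3
    by_cases hc : p = ((π.symm q : Fin n) : ℕ)
    · rw [if_pos hc, if_pos (hiff.1 hc)]
    · rw [if_neg hc, if_neg (mt hiff.2 hc)]
  -- (C) all rows are covered
  have hall : ∀ p < n, Good p := by
    intro p hp
    refine coverIter_induction Good hstep n _ (fun q hq hq0 => ?_) p hp
      (List.all_eq_true.1 (by simpa [coverAll] using hcov) p (List.mem_range.2 hp))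
    rw [List.getD_eq_getElem _ _ (by simpa using hq)] at hq0
    simp only [List.getElem_map, List.getElem_range, List.any_eq_true, beq_iff_eq] at hq0
    obtain ⟨r, hr, rfl⟩ := hq0
    exact hseed r hr
  have hMB : Mv * Bv = leval d v • (1 : Matrix (Fin n) (Fin n) ℝ) := by
    ext p q
    rw [hall p p.2 p.2 q]
    simp only [Matrix.smul_apply, Matrix.one_apply, smul_eq_mul, mul_ite, mul_one, mul_zero,
      Fin.ext_iff]
  refine inv_entry_nonpos_of_mul_eq hE K Bv (leval d v) hdpos hMB x y ?_
  have hBxy := all_range (all_range hB x.2) y.2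
  simp only [Bool.or_eq_true, beq_iff_eq] at hBxy
  rcases hBxy with hxy' | hnp
  · exact absurd (Fin.ext hxy') hxy
  · simpa [hBv] using leval_nonpos hnp hv

/-- **Soundness of the symmetry-reduced checker.** [folklore] -/
theorem inv_entry_nonpos_of_checkSym {Mtab : List (List (List ℤ))} {Bcls : List (List ℤ)}
    {Bidx : List (List ℕ)} {d : List ℤ} {rows : List ℕ} {gens : List (List ℕ × List ℕ)}
    (h : checkSym n E Mtab Bcls Bidx d rows gens = true) (K : ℝ) (hK : 0 ≤ K) (x y : Fin n)
    (hxy : x ≠ y) :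
    (Matrix.of fun p q : Fin n => gksExpect Finset.univ (fun _ : Fin E.length => K) (edgeSet n E)
        (fun ω => spinAt p ω * spinAt q ω))⁻¹ x y ≤ 0 := by
  simp only [checkSym, Bool.and_eq_true] at h
  obtain ⟨hM, hcore⟩ := h
  refine inv_entry_nonpos_of_checkSymCore hcore (fun p hp _ q hq v => ?_) K hK x y hxy
  rw [← entryF_eq]
  exact leval_eq_of_lEq v (all_range (List.all_eq_true.1 hM p hp) hq)

end Soundness

end IsingPolynomial

end Literature.Probability.LatticeModels
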